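import Summits.QuantumFields.YangMills.Theorems.BalabanUVNodesN19TargetNotLawSummableSharp

/-!
# YM-DAG node N19 (= NE7 proper) — N19's TARGET GIVES NO ABSOLUTE-CONVERGENCE BOUND FOR A FIXED LIPSCHITZ OBSERVABLE
# (one level swapped back and forth while the budget allows: ONE test accumulates total variation `N`, for every `N`)

Cell `pub-ymgap`, HUMAN RULING D-0062 (Track A) ∕ D-0149 (work-bound push), R141 (C) wider-strategy seat `pub-ymgap-dag-n19-e` (strategy s3 =
ALTERNATIVE CURRENCY), generation g23, module 4 (lineage module 81).  Route `Summits/QuantumFields/YangMills/Theses/BalabanUVNodes.lean` rev 25,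
cluster item K3⁷ «SpineGivenEndpointR13SepCoPH» (stmt-QuantumFields-20544); filed `--supports` that item `--as helper` (it proves no registered
stub).  COUNT-NEUTRAL: [folklore] over Mathlib + the lineage BY NAME — module 72 `…N19ChebyshevArcLaws` (`exists_chebyshevArc_laws`), module 73
`…N19TargetNotLawSummableSharp` (`pow_div_factorial_le_exp_mul_pow`), module 64 `…N19LawIncrementsTarget` (`abs_log_sub_log_le_of_exp_neg_le`,
`exp_neg_le_mgf_id_of_Icc_symm`); `MatchingModConstants` ∕ `Spine.NE7.Target` (N19's DECL-target SHAPE) are CONCLUDED for explicit TOY families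
`Z_K = mgf λ_K`; no scheme object, no Theses import; NOT a discharge claim.

THE QUESTION.  Modules 68 ∕ 73 ∕ 75–77 show that N19's window currency does not control the bounded-Lipschitz increments of the string laws
SUMMABLY — but with tests `g_K` that CHANGE with `K` (the bounded-Lipschitz METRIC).  For the identity observable and every polynomial of it the
increments ARE summable under `Target` with geometric remainders (p481156: `|E_{K+1} − E_K| ≤ (8e^{1+l₀}∕l₀)·vol·δ_K·(1 + log⁺(2vol·δ_K)⁻¹)`).
What about ONE FIXED Lipschitz observable `g`: does `Target` bound `Σ_K |E_{K+1}g − E_K g|` by anything depending only on `(vol, l₀, δ)` and the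
Lipschitz ∕ sup norms of `g`?

THE ANSWER: NO.  §1 ★ `exists_matchingModConstants_fixedTest_variation_eq` — THE ONE-LEVEL SWAP: if the level-`m` step cost
`4e^{l₀}·l₀^{m−1}∕(m−1)!` (`m ≥ 3`, `2l₀ ≤ m`) fits the budget `vol·δ_K` at every step `K < S` (`δ ≥ 0` elsewhere), then the sequence
`P_m, Q_m, P_m, Q_m, …` (module 72's complementary Chebyshev-arc laws, swapped at every step `K < S` and FROZEN from step `S` on) satisfies
`MatchingModConstants vol l₀ δ (K t ↦ mgf λ_K t)` (constants `0`), and module 72's test polynomial `g_m` — ONE continuous function, `1`-Lipschitz and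
`1∕(2m)`-bounded on `[−1,1]` — is paid `1∕(2m)` at EVERY step `K < S`: `Σ_{K<S} |∫g_m dλ_{K+1} − ∫g_m dλ_K| = S∕(2m)` EXACTLY.  §2 ★★
`exists_target_geometric_fixedTest_variation_ge` — AT THE PROGRAMME'S REMAINDERS: for every `l₀ > 0`, `vol > 0`, `C > 0`, `0 < θ < 1` and every
`N : ℕ` there are probability laws `λ_K` on `[−1,1]` with `Spine.NE7.Target vol l₀ (Cθ^K) (K t ↦ mgf λ_K t)` (N19's DECL-target SHAPE: matching modulo
constants with the geometric remainder AND its summability) and ONE continuous test `g`, `1`-Lipschitz and `1`-bounded on `[−1,1]`, with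
`Σ_{K < 2mN} |∫g dλ_{K+1} − ∫g dλ_K| = N` (the level `m` is affordable for `2mN` steps because `l₀^{m−1}∕(m−1)!` decays faster than `θ^{2NmK}`-type
geometric sequences: module 73's `l₀^k∕k! ≤ e^{l₀∕t²}t^{2k}` at `t = θ^{2N}`).  CONSEQUENCE (prose): no inequality
`Σ_K |E_{K+1}g − E_K g| ≤ F(vol, l₀, C, θ)·(‖g‖_Lip + ‖g‖_∞)` follows from N19's `Target` — smooth (polynomial) observables converge absolutely at the
linear-log price, Lipschitz ones need not.  NOT CLAIMED (open, not filed): ONE law sequence and ONE fixed Lipschitz `g` with `Σ_K |E_{K+1}g − E_K g| = ∞`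
— that needs infinitely many levels seen by one test (a lacunary series of the `g_m`), i.e. a `tsum` of test polynomials; the finite statement here is
what rules out uniform bounds.

HONEST FRAMING (binding).  Elementary and [folklore]; TOY laws; NO consumer in the DAG today (a structural statement about the seat's own currencies);
nothing of Bałaban's instantiated; NE7 NOT PRINTED, NOT proved; N19 NOT discharged; count-neutral.  One finite `T⁴` programme at fixed `ε`; nothing
continuum ∕ `ℝ⁴` ∕ OS ∕ mass-gap ∕ Clay.  0 `def` ∕ 0 `sorry`.
-/

noncomputable section

open Real MeasureTheory ProbabilityTheory

namespace Summit.QuantumFields.YangMills.Theorems.BalabanUVNodesN19TargetNoFixedTestBound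

open Literature.MathematicalPhysics.QuantumFieldTheory.Balaban1983to89
open T4CauchySum (MatchingModConstants)
open Summit.QuantumFields.BalabanUV.T4Continuum.Spine
open Summit.QuantumFields.YangMills.Theorems.BalabanUVNodesN19LawIncrementsTarget (abs_log_sub_log_le_of_exp_neg_le exp_neg_le_mgf_id_of_Icc_symm)
open Summit.QuantumFields.YangMills.Theorems.BalabanUVNodesN19ChebyshevArcLaws (exists_chebyshevArc_laws)
open Summit.QuantumFields.YangMills.Theorems.BalabanUVNodesN19TargetNotLawSummableSharp (pow_div_factorial_le_exp_mul_pow)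

/-! ## §1 The one-level swap: a fixed test paid at every affordable step [folklore] -/

/-- ★ **THE ONE-LEVEL SWAP.**  `0 < vol`, `δ ≥ 0`; a level `m ≥ 3` with `2l₀ ≤ m` whose step cost `4e^{l₀}·l₀^{m−1}∕(m−1)!` fits `vol·δ_K` for
every `K < S`.  Then there are probability laws `λ_K` on `[−1,1]` (module 72's `P_m, Q_m` swapped at the steps `K < S`, frozen afterwards) with
`MatchingModConstants vol l₀ δ (K t ↦ mgf λ_K t)` and ONE continuous test `g`, `1`-Lipschitz and `1∕(2m)`-bounded on `[−1,1]`, with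
`Σ_{K<S} |∫g dλ_{K+1} − ∫g dλ_K| = S∕(2m)`. [folklore] -/
theorem exists_matchingModConstants_fixedTest_variation_eq {l₀ vol : ℝ} (hvol : 0 < vol) {δ : ℕ → ℝ} (hδ : ∀ K, 0 ≤ δ K)
    {m : ℕ} (hm : 3 ≤ m) (hml : 2 * l₀ ≤ m) {S : ℕ}
    (hfit : ∀ K, K < S → 4 * Real.exp l₀ * (l₀ ^ (m - 1) / ((m - 1).factorial : ℝ)) ≤ vol * δ K) :
    ∃ Λ : ℕ → Measure ℝ, (∀ K, IsProbabilityMeasure (Λ K)) ∧ (∀ K, Λ K (Set.Icc (-1 : ℝ) 1)ᶜ = 0) ∧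
      MatchingModConstants vol l₀ δ (fun K t => mgf id (Λ K) t) ∧
      ∃ g : ℝ → ℝ, Continuous g ∧
        (∀ x y : ℝ, x ∈ Set.Icc (-1 : ℝ) 1 → y ∈ Set.Icc (-1 : ℝ) 1 → |g x - g y| ≤ 1 * |x - y|) ∧
        (∀ x : ℝ, x ∈ Set.Icc (-1 : ℝ) 1 → |g x| ≤ 1 / (2 * m)) ∧
        ∑ K ∈ Finset.range S, |∫ x, g x ∂Λ (K + 1) - ∫ x, g x ∂Λ K| = S / (2 * m) := by
  classical
  obtain ⟨P, Q, iP, iQ, hPc, hQc, hmgf, g, hgc, hgL, hgB, hpay⟩ := exists_chebyshevArc_laws (n := m) hm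
  -- the swap cost on the window: `|mgf Q − mgf P| ≤ 4·l₀^{m−1}∕(m−1)!`
  set b : ℝ := l₀ ^ (m - 1) / ((m - 1).factorial : ℝ) with hb
  have hPQ : ∀ t : ℝ, |t| ≤ l₀ → |mgf id Q t - mgf id P t| ≤ 4 * b := fun t ht => by
    obtain ⟨h1, h2⟩ := hmgf l₀ t hml ht
    calc |mgf id Q t - mgf id P t|
        ≤ |mgf id Q t - 1 / 2 * ∫ x in (-1 : ℝ)..1, Real.exp (t * x)| +
          |1 / 2 * (∫ x in (-1 : ℝ)..1, Real.exp (t * x)) - mgf id P t| := abs_sub_le _ _ _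
      _ = |mgf id Q t - 1 / 2 * ∫ x in (-1 : ℝ)..1, Real.exp (t * x)| +
          |mgf id P t - 1 / 2 * ∫ x in (-1 : ℝ)..1, Real.exp (t * x)| := by rw [abs_sub_comm (1 / 2 * _) (mgf id P t)]
      _ ≤ 2 * b + 2 * b := add_le_add h2 h1
      _ = 4 * b := by ring
  -- the alternating chain, frozen from step `S` on
  set X : ℕ → Measure ℝ := fun j => if Even j then P else Q with hX
  set Λ : ℕ → Measure ℝ := fun K => X (min K S) with hΛ
  have hXP : ∀ j, IsProbabilityMeasure (X j) := fun j => by simp only [hX]; split_ifs <;> infer_instance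
  have hXc : ∀ j, X j (Set.Icc (-1 : ℝ) 1)ᶜ = 0 := fun j => by simp only [hX]; split_ifs; exacts [hPc, hQc]
  have hΛP : ∀ K, IsProbabilityMeasure (Λ K) := fun K => hXP _
  have hΛc : ∀ K, Λ K (Set.Icc (-1 : ℝ) 1)ᶜ = 0 := fun K => hXc _
  -- consecutive members of the chain: `{X j, X (j+1)} = {P, Q}`
  have hXswap : ∀ j, (X j = P ∧ X (j + 1) = Q) ∨ (X j = Q ∧ X (j + 1) = P) := fun j => by
    rcases Nat.even_or_odd j with hj | hj
    · left
      have h1 : ¬Even (j + 1) := Nat.not_even_iff_odd.2 hj.add_one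
      simp only [hX, hj, if_true, h1, if_false, and_self]
    · right
      have h0 : ¬Even j := Nat.not_even_iff_odd.2 hj
      have h1 : Even (j + 1) := hj.add_one
      simp only [hX, h0, if_false, h1, if_true, and_self]
  have hmove : ∀ K, K < S → Λ K = X K ∧ Λ (K + 1) = X (K + 1) := fun K hK =>
    ⟨by simp only [hΛ, min_eq_left hK.le], by simp only [hΛ, min_eq_left (Nat.succ_le_of_lt hK)]⟩
  have hfreeze : ∀ K, S ≤ K → Λ (K + 1) = Λ K := fun K hK => by
    simp only [hΛ, min_eq_right hK, min_eq_right (hK.trans (Nat.le_succ K))]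
  refine ⟨Λ, hΛP, hΛc, fun K => ⟨0, fun t ht => ?_⟩, g, hgc, hgL, hgB, ?_⟩
  · -- matching modulo the constants `0`
    rw [sub_zero]
    change |cgf id (Λ (K + 1)) t - cgf id (Λ K) t| ≤ vol * δ K
    rcases lt_or_ge K S with hK | hK
    · obtain ⟨e0, e1⟩ := hmove K hK
      have hlow : ∀ j, Real.exp (-l₀) ≤ mgf id (X j) t := fun j => by
        haveI := hXP j
        exact exp_neg_le_mgf_id_of_Icc_symm (X j) (hXc j) ht
      have hmX : |mgf id (X (K + 1)) t - mgf id (X K) t| ≤ 4 * b := by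
        rcases hXswap K with ⟨h0, h1⟩ | ⟨h0, h1⟩
        · rw [h0, h1]; exact hPQ t ht
        · rw [h0, h1, abs_sub_comm]; exact hPQ t ht
      rw [e0, e1]
      calc |cgf id (X (K + 1)) t - cgf id (X K) t| = |Real.log (mgf id (X (K + 1)) t) - Real.log (mgf id (X K) t)| := by rw [cgf, cgf]
        _ ≤ Real.exp l₀ * |mgf id (X (K + 1)) t - mgf id (X K) t| := abs_log_sub_log_le_of_exp_neg_le (hlow _) (hlow _)
        _ ≤ Real.exp l₀ * (4 * b) := mul_le_mul_of_nonneg_left hmX (Real.exp_pos _).le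
        _ = 4 * Real.exp l₀ * b := by ring
        _ ≤ vol * δ K := hfit K hK
    · rw [hfreeze K hK, sub_self, abs_zero]
      exact mul_nonneg hvol.le (hδ K)
  · -- the fixed test is paid `1∕(2m)` at every step `K < S`
    have hterm : ∀ K ∈ Finset.range S, |∫ x, g x ∂Λ (K + 1) - ∫ x, g x ∂Λ K| = 1 / (2 * m) := by
      intro K hK
      obtain ⟨e0, e1⟩ := hmove K (Finset.mem_range.1 hK)
      rw [e0, e1]
      have hmpos : (0 : ℝ) < 1 / (2 * m) := by
        have : (0 : ℝ) < m := by exact_mod_cast (by omega : 0 < m)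
        positivity
      rcases hXswap K with ⟨h0, h1⟩ | ⟨h0, h1⟩
      · rw [h0, h1, abs_sub_comm, hpay, abs_of_pos hmpos]
      · rw [h0, h1, hpay, abs_of_pos hmpos]
    rw [Finset.sum_congr rfl hterm, Finset.sum_const, Finset.card_range, nsmul_eq_mul]
    ring

/-! ## §2 At the programme's geometric remainders: total variation `N` for every `N`, under `Target` [folklore] -/

/-- ★★ **NO ABSOLUTE-CONVERGENCE BOUND FOR A FIXED LIPSCHITZ OBSERVABLE FROM N19's TARGET.**  For every `l₀ > 0`, `vol > 0`, `C > 0`, `0 < θ < 1`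
and every `N : ℕ` there are probability laws `λ_K` on `[−1,1]` with `Spine.NE7.Target vol l₀ (K ↦ Cθ^K) (K t ↦ mgf λ_K t)` — N19's DECL-target
SHAPE at the geometric remainder, summability included — and ONE continuous test `g`, `1`-Lipschitz and `1`-bounded on `[−1,1]`, and a level `m`
with `Σ_{K < 2mN} |∫g dλ_{K+1} − ∫g dλ_K| = N`: the expectations of ONE fixed Lipschitz observable may have total variation as large as we please
along sequences admitted by `Target`, so no bound `Σ_K |E_{K+1}g − E_K g| ≤ F(vol,l₀,C,θ)·(‖g‖_Lip + ‖g‖_∞)` follows from it. [folklore] -/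
theorem exists_target_geometric_fixedTest_variation_ge {l₀ vol C θ : ℝ} (hl₀ : 0 < l₀) (hvol : 0 < vol) (hC : 0 < C)
    (hθ0 : 0 < θ) (hθ1 : θ < 1) (N : ℕ) :
    ∃ Λ : ℕ → Measure ℝ, (∀ K, IsProbabilityMeasure (Λ K)) ∧ (∀ K, Λ K (Set.Icc (-1 : ℝ) 1)ᶜ = 0) ∧
      NE7.Target vol l₀ (fun K => C * θ ^ K) (fun K t => mgf id (Λ K) t) ∧
      ∃ g : ℝ → ℝ, Continuous g ∧
        (∀ x y : ℝ, x ∈ Set.Icc (-1 : ℝ) 1 → y ∈ Set.Icc (-1 : ℝ) 1 → |g x - g y| ≤ 1 * |x - y|) ∧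
        (∀ x : ℝ, x ∈ Set.Icc (-1 : ℝ) 1 → |g x| ≤ 1) ∧
        ∃ m : ℕ, ∑ K ∈ Finset.range (2 * m * N), |∫ x, g x ∂Λ (K + 1) - ∫ x, g x ∂Λ K| = N := by
  -- the geometric scale `t = θ^{2N}` and the constant `A = 4e^{l₀}e^{l₀∕t²}∕(vol·C·θ)`
  set t : ℝ := θ ^ (2 * N) with ht
  have ht0 : 0 < t := by positivity
  have ht1 : t ≤ 1 := pow_le_one₀ hθ0.le hθ1.le
  set A : ℝ := 4 * Real.exp l₀ * Real.exp (l₀ / t ^ 2) with hA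
  have hA0 : 0 < A := by positivity
  -- choose the level `m ≥ max(3, ⌈2l₀⌉)` so large that `A·θ^{m−1} ≤ vol·C` (possible since `θ < 1`)
  obtain ⟨n₀, hn₀⟩ := exists_pow_lt_of_lt_one (div_pos (mul_pos hvol hC) hA0) hθ1
  set m : ℕ := max (max 3 ⌈2 * l₀⌉₊) (n₀ + 1) with hmdef
  have hm3 : 3 ≤ m := (le_max_left _ _).trans (le_max_left _ _)
  have hml : 2 * l₀ ≤ m := (Nat.le_ceil _).trans (by exact_mod_cast (le_max_right 3 _).trans (le_max_left _ (n₀ + 1)))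
  have hmn : n₀ ≤ m - 1 := by omega
  have hθpow : θ ^ (m - 1) ≤ θ ^ n₀ := pow_le_pow_of_le_one hθ0.le hθ1.le hmn
  have hAθ : A * θ ^ (m - 1) ≤ vol * C := by
    have h1 : A * θ ^ (m - 1) ≤ A * θ ^ n₀ := mul_le_mul_of_nonneg_left hθpow hA0.le
    have h2 : A * θ ^ n₀ ≤ A * (vol * C / A) := mul_le_mul_of_nonneg_left hn₀.le hA0.le
    have h3 : A * (vol * C / A) = vol * C := by field_simp
    linarith
  -- the level-`m` step cost fits `vol·C·θ^K` for every `K < 2mN`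
  have hfit : ∀ K, K < 2 * m * N → 4 * Real.exp l₀ * (l₀ ^ (m - 1) / ((m - 1).factorial : ℝ)) ≤ vol * (C * θ ^ K) := by
    intro K hK
    have hfac := pow_div_factorial_le_exp_mul_pow hl₀.le ht0 (m - 1)
    -- `t^{2(m−1)} = θ^{4N(m−1)} ≤ θ^{K + (m−1)}`: `4N(m−1) − (K + m − 1) ≥ (2N−1)(m−2) ≥ 0` for `K < 2mN` (so `N ≥ 1`) and `m ≥ 3`
    have hN : 1 ≤ N := by
      rcases Nat.eq_zero_or_pos N with h | h
      · subst h; simp at hK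
      · exact h
    obtain ⟨m', hm'⟩ : ∃ m', m = m' + 3 := ⟨m - 3, by omega⟩
    have hexp : K + (m - 1) ≤ 2 * N * (2 * (m - 1)) := by
      have e : m - 1 = m' + 2 := by omega
      rw [e]
      rw [hm'] at hK
      nlinarith [Nat.mul_le_mul_right m' hN, hK, hN]
    have hpow : t ^ (2 * (m - 1)) ≤ θ ^ K * θ ^ (m - 1) := by
      rw [ht, ← pow_mul, ← pow_add]
      exact pow_le_pow_of_le_one hθ0.le hθ1.le hexp
    calc 4 * Real.exp l₀ * (l₀ ^ (m - 1) / ((m - 1).factorial : ℝ))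
        ≤ 4 * Real.exp l₀ * (Real.exp (l₀ / t ^ 2) * t ^ (2 * (m - 1))) := mul_le_mul_of_nonneg_left hfac (by positivity)
      _ ≤ 4 * Real.exp l₀ * (Real.exp (l₀ / t ^ 2) * (θ ^ K * θ ^ (m - 1))) := by gcongr
      _ = (A * θ ^ (m - 1)) * θ ^ K := by rw [hA]; ring
      _ ≤ (vol * C) * θ ^ K := mul_le_mul_of_nonneg_right hAθ (by positivity)
      _ = vol * (C * θ ^ K) := by ring
  obtain ⟨Λ, hP, hc, hM, g, hgc, hgL, hgB, hsum⟩ :=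
    exists_matchingModConstants_fixedTest_variation_eq hvol (δ := fun K => C * θ ^ K) (fun K => by positivity) hm3 hml hfit
  have hmpos : (0 : ℝ) < m := by exact_mod_cast (by omega : 0 < m)
  refine ⟨Λ, hP, hc, ⟨hM, (summable_geometric_of_lt_one hθ0.le hθ1).mul_left C⟩, g, hgc, hgL, fun x hx => (hgB x hx).trans ?_, m, ?_⟩
  · rw [div_le_one (by positivity)]
    have : (1 : ℝ) ≤ m := by exact_mod_cast (by omega : 1 ≤ m)
    linarith
  · rw [hsum, div_eq_iff (by positivity)]
    push_cast
    ring

end Summit.QuantumFields.YangMills.Theorems.BalabanUVNodesN19TargetNoFixedTestBound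

end
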